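import Literature.MathematicalPhysics.QuantumLattice.TorusSectorGibbsMixtureSymmetry
import Literature.MathematicalPhysics.QuantumLattice.TwistedFlipSpaceGroupUnitary
import Literature.MathematicalPhysics.QuantumLattice.InfVolFermionStateSpinFlip
import HarnessLib

/-!
# Spin-exchange symmetry of the canonical `S^z = 0` Gibbs states of the `t–t'` Hubbard torus, and
# spin-flip invariance of thermal torus-limit states

Topic `Literature/MathematicalPhysics/QuantumLattice`; companion of `TorusSectorGibbsMixtureSymmetry.lean`
(point group and translations) for the remaining element of the square-lattice symmetry set a state
relaxation identifies «w.l.o.g.» (translations, `U(1)×U(1)` gauge, `D₄`, SPIN FLIP): the spin exchange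
`Γ_swap : c_{xσ} ↦ c_{x,1−σ}` (`relabel Orb.spinSwap`; on the torus the unitary `F = fockSpinFlip`,
`TwistedFlipSpaceGroupUnitary.lean`; on infinite-volume states `ω ↦ ω.spinFlip`,
`InfVolFermionStateSpinFlip.lean`). The sector `(N, S^z = 0)` is mapped to itself by `F` (`F` commutes with
`N` and anticommutes with `S^z`) and `F` commutes with `H_L = hubbardTorusTT' L t t' U`, so by the unitary
invariance of canonical sector Gibbs states (`SectorGibbsMixtureInvariance.lean`):

* `fockRelabel_spinSwap_mulVec_mem_szSector_zero` (any orbital set) / `fockSpinFlip_mulVec_mem_szSector_zero` —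
  the spin exchange preserves every `szSector N 0` (`S^z Γ = −Γ S^z`, `spinZ_mul_fockRelabel_spinSwap`);
* `sum_sectorGibbsWeightTT'_mul_expect_fockSpinFlip_mulVec_eq` — the canonical Gibbs data
  `(p_{L,i}, ψ_{L,i})` of `(rectN n L, S^z = 0)` satisfy `Σ_i p_i ⟨Fψ_i, Y Fψ_i⟩ = Σ_i p_i ⟨ψ_i, Y ψ_i⟩`
  for every torus operator `Y`;
* `sum_sectorGibbsWeightTT'_mul_torusAvgExpectAt_relabel_spinSwap` — the weighted translation average of
  `Γ_swap A` equals that of `A` (`Γ(ι) ∘ Γ_swap = Γ_swap ∘ Γ(ι)`, `F U_v = U_v F`);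
* `IsTorusLimitOfMixture.spinFlip_eq_of_sectorGibbs` — **every torus limit of the canonical `S^z = 0`
  sector Gibbs states is spin-flip invariant**, `ω.spinFlip = ω`; hence it kills every spin-flip defect
  `Γ_swap Y − Y` of a window certificate (`…expect_relabel_spinSwap_sub_eq_zero_of_sectorGibbs`).

Everything is PROVED; no definition, no named fact, no instance. (Full `SU(2)` is NOT available for the
`S^z = 0` sector state: only `U(1)_z ⋊ flip`.)

## Mathlib / tree search

REUSED: `sum_sectorGibbsWeightTT'_mul_expect_mulVec_eq` (`TorusSectorGibbsMixtureSymmetry`),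
`apply_eq_zero_off_of_mulVec_mem` (`GibbsEnergyEntropyBalance`), `fockSpinFlip`,
`fockSpinFlip_commute_hubbardTorusTT'`, `fockSpinFlip_commute_totalNumber`, `conjTranspose_fockSpinFlip`,
`Orb.spinSwap_mul_translate` (`TwistedFlipSpaceGroupUnitary`), `relabel_spinSwap_spinZ`
(`HubbardSpinFlipSymmetry`), `fermionEmbed_relabel_spinSwap`, `spinFlip_expect` (`InfVolFermionStateSpinFlip`),
`relabel_eq_fockRelabel_conj`, `mem_szSector_iff`, `nParticleSubmodule_eq_eigenspace_holds`,
`mulVec_mem_eigenspace_of_commute`, `star_mulVec_dotProduct_mulVec_mulVec`, `torusAvgExpectAt_of_injOn`.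
`lean search 'spinFlip.*Gibbs|IsTorusLimitOfMixture.*spinFlip'`: nothing (2026-08-26).

## References

* G. Benfatto, A. Giuliani, V. Mastropietro, Ann. Henri Poincaré 7 (2006) 809, §2.1 (spin-exchange symmetry
  of the Hubbard Hamiltonian). [cite: BenfattoGiulianiMastropietro2006, §2.1]
* X. Han, arXiv:2006.06002 (2020), §3 (symmetry constraints `⟨g·O⟩ = ⟨O⟩`). [cite: Han2020Bootstrap, §3]
* R. B. Israel, *Convexity in the Theory of Lattice Gases* (1979), §I.3 eq. (26). [cite: Israel1979, §I.3 eq. (26)]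
-/

noncomputable section

namespace Literature.MathematicalPhysics.QuantumLattice

open Matrix Finset HubbardWave0 Literature.Probability.LatticeModels ThermodynamicLimit
open _root_.Filter
open scoped _root_.Topology ComplexOrder BigOperators

section Torus

variable (L : ℕ) [NeZero L]

/-- `X Uᴴ U = X` from `U⋆U = 1`, the `DecidableEq` instance an implicit ARGUMENT (cf.
`TorusGibbsEnergyEntropyBalance`). [folklore] -/
private theorem mul_conjTranspose_mul_self_of_star_mul_self {ι : Type*} [Fintype ι] {_dec : DecidableEq ι}
    {U : Matrix ι ι ℂ} (h : star U * U = 1) (X : Matrix ι ι ℂ) : X * Uᴴ * U = X := by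
  rw [Matrix.mul_assoc, ← Matrix.star_eq_conjTranspose, h, Matrix.mul_one]

/-- `U (Uᴴ X) = X` from `UU⋆ = 1` (same remark). [folklore] -/
private theorem mul_conjTranspose_mul_of_mul_star_self'' {ι : Type*} [Fintype ι] {_dec : DecidableEq ι}
    {U : Matrix ι ι ℂ} (h : U * star U = 1) (X : Matrix ι ι ℂ) : U * (Uᴴ * X) = X := by
  rw [← Matrix.mul_assoc, ← Matrix.star_eq_conjTranspose, h, Matrix.one_mul]

omit [NeZero L] in
/-- `F (Fᴴ X) = X` for the spin exchange (instance-free form). [cite: BenfattoGiulianiMastropietro2006, §2.1] -/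
theorem fockSpinFlip_mul_conjTranspose_mul
    (X : Matrix (Finset (Orb (FermionTorus 2 L))) (Finset (Orb (FermionTorus 2 L))) ℂ) :
    fockSpinFlip * ((fockSpinFlip : Matrix (Finset (Orb (FermionTorus 2 L))) _ ℂ)ᴴ * X) = X := by
  rw [fockSpinFlip_def]
  exact mul_conjTranspose_mul_of_mul_star_self''
    (fockRelabel (Orb.spinSwap : Orb (FermionTorus 2 L) ≃ Orb (FermionTorus 2 L))).2.2 X

end Torus

section Generic

variable {Λ : Type*} [LinearOrder Λ] [Fintype Λ]

/-- **`S^z Γ = −Γ S^z`** for the spin-exchange unitary `Γ = fockRelabel Orb.spinSwap` of any finite orbital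
set (`Γ S^z Γᴴ = −S^z`, `relabel_spinSwap_spinZ`). [cite: BenfattoGiulianiMastropietro2006, §2.1] -/
theorem spinZ_mul_fockRelabel_spinSwap :
    (HubbardWave0.spinZ : Matrix (Finset (Orb Λ)) _ ℂ) * (fockRelabel (Orb.spinSwap : Orb Λ ≃ Orb Λ)).val =
      -((fockRelabel (Orb.spinSwap : Orb Λ ≃ Orb Λ)).val * HubbardWave0.spinZ) := by
  have h := relabel_spinSwap_spinZ (Λ := Λ)
  rw [relabel_eq_fockRelabel_conj] at h
  have h2 : (fockRelabel (Orb.spinSwap : Orb Λ ≃ Orb Λ)).val * HubbardWave0.spinZ *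
      (fockRelabel (Orb.spinSwap : Orb Λ ≃ Orb Λ)).valᴴ * (fockRelabel (Orb.spinSwap : Orb Λ ≃ Orb Λ)).val =
      -HubbardWave0.spinZ * (fockRelabel (Orb.spinSwap : Orb Λ ≃ Orb Λ)).val :=
    congrArg (fun M : Matrix (Finset (Orb Λ)) _ ℂ => M * (fockRelabel (Orb.spinSwap : Orb Λ ≃ Orb Λ)).val) h
  rw [mul_conjTranspose_mul_self_of_star_mul_self (fockRelabel (Orb.spinSwap : Orb Λ ≃ Orb Λ)).2.1,
    Matrix.neg_mul] at h2
  rw [h2, neg_neg]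

/-- **The spin exchange preserves the `S^z = 0` sectors**: `ψ ∈ (N, S^z = 0) ⇒ Γψ ∈ (N, S^z = 0)`
(`Γ` commutes with `N̂` and anticommutes with `S^z`). [cite: LiebPRL1989, eq. (2)] -/
theorem fockRelabel_spinSwap_mulVec_mem_szSector_zero {N : ℕ} {ψ : Fock (Orb Λ)} (hψ : ψ ∈ szSector N 0) :
    (fockRelabel (Orb.spinSwap : Orb Λ ≃ Orb Λ)).val *ᵥ ψ ∈ szSector N 0 := by
  unfold szSector at hψ ⊢
  rw [Submodule.mem_inf] at hψ ⊢
  refine ⟨?_, ?_⟩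
  · have h1 := hψ.1
    rw [nParticleSubmodule_eq_eigenspace_holds N] at h1 ⊢
    have hN : Commute (fockRelabel (Orb.spinSwap : Orb Λ ≃ Orb Λ)).val
        (totalNumberOp : Matrix (Finset (Orb Λ)) _ ℂ) := by
      rw [totalNumberOp_eq_totalNumber]
      exact fockRelabel_commute_of_relabel_eq _ relabel_spinSwap_totalNumber
    exact mulVec_mem_eigenspace_of_commute hN h1
  · have h2 := hψ.2
    rw [Module.End.mem_eigenspace_iff, Matrix.toLin'_apply] at h2 ⊢
    rw [mulVec_mulVec, spinZ_mul_fockRelabel_spinSwap, neg_mulVec, ← mulVec_mulVec, h2, Complex.ofReal_zero,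
      zero_smul, mulVec_zero, neg_zero, zero_smul]

end Generic

section Torus

variable (L : ℕ) [NeZero L]

omit [NeZero L] in
/-- On the torus: `F` (`fockSpinFlip`) preserves every `szSector N 0`. [cite: LiebPRL1989, eq. (2)] -/
theorem fockSpinFlip_mulVec_mem_szSector_zero {N : ℕ} {ψ : Fock (Orb (FermionTorus 2 L))}
    (hψ : ψ ∈ szSector N 0) :
    (fockSpinFlip : Matrix (Finset (Orb (FermionTorus 2 L))) _ ℂ) *ᵥ ψ ∈ szSector N 0 := by
  rw [fockSpinFlip_def]
  exact fockRelabel_spinSwap_mulVec_mem_szSector_zero hψ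

omit [NeZero L] in
/-- `F` has no matrix entries from the sector `(rectN n L, S^z = 0)` to its complement.
[cite: LiebPRL1989, eq. (2)] -/
theorem fockSpinFlip_apply_eq_zero_of_szConfig (n : ℝ) (s s' : Finset (Orb (FermionTorus 2 L)))
    (hs : ¬ szConfig n L s) (hs' : szConfig n L s') :
    (fockSpinFlip : Matrix (Finset (Orb (FermionTorus 2 L))) _ ℂ) s s' = 0 :=
  apply_eq_zero_off_of_mulVec_mem (szConfig n L) (szSector (rectN n L) 0) (mem_szSector_rectN_iff n L)
    (fun _ hv => fockSpinFlip_mulVec_mem_szSector_zero L hv) s s' hs hs'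

/-- **Spin-exchange invariance of the canonical `S^z = 0` Gibbs state of the torus**: for every torus
operator `Y`, `Σ_i p_{L,i} ⟨Fψ_{L,i}, Y Fψ_{L,i}⟩ = Σ_i p_{L,i} ⟨ψ_{L,i}, Y ψ_{L,i}⟩`.
[cite: Israel1979, §I.3 eq. (26)] -/
theorem sum_sectorGibbsWeightTT'_mul_expect_fockSpinFlip_mulVec_eq (t t' U n β : ℝ)
    (Y : Matrix (Finset (Orb (FermionTorus 2 L))) (Finset (Orb (FermionTorus 2 L))) ℂ) :
    ∑ i, (sectorGibbsWeightTT' β t t' U n L i : ℂ) *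
        expect Y ((fockSpinFlip : Matrix (Finset (Orb (FermionTorus 2 L))) _ ℂ) *ᵥ sectorGibbsVectorTT' t t' U n L i) =
      ∑ i, (sectorGibbsWeightTT' β t t' U n L i : ℂ) * expect Y (sectorGibbsVectorTT' t t' U n L i) := by
  refine sum_sectorGibbsWeightTT'_mul_expect_mulVec_eq L t t' U n β (fockSpinFlip_mul_conjTranspose_mul L)
    (fockSpinFlip_commute_hubbardTorusTT' t t' U) (fockSpinFlip_apply_eq_zero_of_szConfig L n)
    (fun s s' hs hs' => ?_) Y
  rw [conjTranspose_fockSpinFlip]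
  exact fockSpinFlip_apply_eq_zero_of_szConfig L n s s' hs hs'

/-- `F U_v = U_v F`. [cite: Han2020Bootstrap, §3] -/
theorem fockSpinFlip_mul_fockTranslate_val (v : TorusSite 2 L) :
    (fockSpinFlip : Matrix (Finset (Orb (FermionTorus 2 L))) _ ℂ) * (fockTranslate v).val =
      (fockTranslate v).val * fockSpinFlip := by
  have h : fockRelabel (Orb.spinSwap : Orb (FermionTorus 2 L) ≃ Orb (FermionTorus 2 L)) * fockTranslate v =
      fockTranslate v * fockRelabel (Orb.spinSwap : Orb (FermionTorus 2 L) ≃ Orb (FermionTorus 2 L)) := by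
    rw [fockTranslate, ← map_mul, ← map_mul]
    exact congrArg _ (Orb.spinSwap_mul_translate v)
  rw [fockSpinFlip_def]
  exact congrArg Subtype.val h

/-- **The weighted translation average of `Γ_swap A` equals that of `A`** in the canonical `S^z = 0` Gibbs
mixture of the torus (`Λ` fitting into the torus, `A ∈ 𝔄_Λ`). [cite: Han2020Bootstrap, §3] -/
theorem sum_sectorGibbsWeightTT'_mul_torusAvgExpectAt_relabel_spinSwap (t t' U n β : ℝ)
    {Λ : Finset (Site 2)} (hInj : Set.InjOn (Torus.proj (d := 2) L) ↑Λ) (A : FermionOp Λ) :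
    ∑ i, (sectorGibbsWeightTT' β t t' U n L i : ℂ) *
        torusAvgExpectAt L Λ (relabel (Orb.spinSwap : Orb (PolySite Λ) ≃ Orb (PolySite Λ)) A)
          (sectorGibbsVectorTT' t t' U n L i) =
      ∑ i, (sectorGibbsWeightTT' β t t' U n L i : ℂ) *
        torusAvgExpectAt L Λ A (sectorGibbsVectorTT' t t' U n L i) := by
  set B := fermionEmbed (PolySite.toTorusEmb L hInj) A with hB
  set F : Matrix (Finset (Orb (FermionTorus 2 L))) _ ℂ := fockSpinFlip with hF
  have hpull : fermionEmbed (PolySite.toTorusEmb L hInj)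
      (relabel (Orb.spinSwap : Orb (PolySite Λ) ≃ Orb (PolySite Λ)) A) = F * B * Fᴴ := by
    rw [fermionEmbed_relabel_spinSwap, relabel_eq_fockRelabel_conj, ← fockSpinFlip_def]
  -- `⟨U_vψ, F B Fᴴ U_vψ⟩ = ⟨U_v Fᴴψ, B U_v Fᴴψ⟩`
  have hterm : ∀ (v : TorusSite 2 L) (ψ : Fock (Orb (FermionTorus 2 L))),
      expect (F * B * Fᴴ) ((fockTranslate v).val *ᵥ ψ) = expect B ((fockTranslate v).val *ᵥ (Fᴴ *ᵥ ψ)) := by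
    intro v ψ
    have hvec : (fockTranslate v).val *ᵥ (Fᴴ *ᵥ ψ) = Fᴴ *ᵥ ((fockTranslate v).val *ᵥ ψ) := by
      rw [mulVec_mulVec, mulVec_mulVec, hF, conjTranspose_fockSpinFlip, fockSpinFlip_mul_fockTranslate_val]
    rw [expect, expect, hvec, star_mulVec_dotProduct_mulVec_mulVec Fᴴ B, conjTranspose_conjTranspose]
  have havg : ∀ ψ : Fock (Orb (FermionTorus 2 L)),
      torusAvgExpectAt L Λ (relabel (Orb.spinSwap : Orb (PolySite Λ) ≃ Orb (PolySite Λ)) A) ψ =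
        torusAvgExpectAt L Λ A (Fᴴ *ᵥ ψ) := by
    intro ψ
    rw [torusAvgExpectAt_of_injOn L hInj, torusAvgExpectAt_of_injOn L hInj, hpull,
      Finset.sum_congr rfl fun v _ => hterm v ψ]
  have h1 : ∀ (u : TorusSite 2 L) (φ : Fock (Orb (FermionTorus 2 L))), expect B ((fockTranslate u).val *ᵥ φ) =
      expect ((fockTranslate u).valᴴ * B * (fockTranslate u).val) φ := fun u φ => by
    rw [expect, expect, star_mulVec_dotProduct_mulVec_mulVec (fockTranslate u).val B]
  have hswap : ∀ χ : Fin (sectorGibbsCount n L) → Fock (Orb (FermionTorus 2 L)),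
      ∑ i, (sectorGibbsWeightTT' β t t' U n L i : ℂ) * torusAvgExpectAt L Λ A (χ i) =
        ((Fintype.card (TorusSite 2 L) : ℂ))⁻¹ * ∑ u : TorusSite 2 L, ∑ i,
          (sectorGibbsWeightTT' β t t' U n L i : ℂ) *
            expect ((fockTranslate u).valᴴ * B * (fockTranslate u).val) (χ i) := by
    intro χ
    rw [Finset.sum_comm, Finset.mul_sum]
    refine Finset.sum_congr rfl fun i _ => ?_
    rw [torusAvgExpectAt_of_injOn L hInj, Finset.mul_sum, Finset.mul_sum, Finset.mul_sum]
    refine Finset.sum_congr rfl fun u _ => ?_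
    rw [h1, mul_left_comm]
  rw [Finset.sum_congr rfl fun i _ => by rw [havg], hswap (fun i => Fᴴ *ᵥ sectorGibbsVectorTT' t t' U n L i),
    hswap (fun i => sectorGibbsVectorTT' t t' U n L i)]
  refine congrArg (fun z => ((Fintype.card (TorusSite 2 L) : ℂ))⁻¹ * z) (Finset.sum_congr rfl fun u _ => ?_)
  simp only [hF, conjTranspose_fockSpinFlip]
  exact sum_sectorGibbsWeightTT'_mul_expect_fockSpinFlip_mulVec_eq L t t' U n β _

namespace InfVolFermionState

/-- **Thermal torus limits are spin-flip invariant.** Every torus limit `ω` of the canonical Gibbs states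
of `hubbardTorusTT' (Ls j) t t' U` at inverse temperature `β` on the sectors `(rectN n (Ls j), S^z = 0)`
(`Ls → ∞`; any `β, t, t', U, n`) satisfies `ω ∘ Γ_swap = ω` (`ω.spinFlip = ω`).
[cite: BenfattoGiulianiMastropietro2006, §2.1] -/
theorem IsTorusLimitOfMixture.spinFlip_eq_of_sectorGibbs (t t' U n β : ℝ)
    {ω : InfVolFermionState 2} {Ls : ℕ → ℕ}
    (h : ω.IsTorusLimitOfMixture (sectorGibbsCount n) (fun L => sectorGibbsWeightTT' β t t' U n L)
      (fun L => sectorGibbsVectorTT' t t' U n L) Ls)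
    (hLs : Tendsto Ls atTop atTop) : ω.spinFlip = ω := by
  refine InfVolFermionState.ext fun Λ => LinearMap.ext fun A => ?_
  rw [spinFlip_expect]
  refine tendsto_nhds_unique (h Λ _) ((h Λ A).congr' ?_)
  filter_upwards [eventually_injOn_proj_of_tendsto Λ hLs, hLs.eventually_ge_atTop 1] with j h1 hj
  haveI : NeZero (Ls j) := ⟨by omega⟩
  simp_rw [torusAvgExpect_eq]
  exact (sum_sectorGibbsWeightTT'_mul_torusAvgExpectAt_relabel_spinSwap (Ls j) t t' U n β h1 A).symm

/-- **Thermal torus limits kill the spin-flip defects of a window certificate**: for every region `Λ'`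
and `Y ∈ 𝔄_{Λ'}`, `ω_{Λ'}(Γ_swap Y − Y) = 0`. [cite: Han2020Bootstrap, §3] -/
theorem IsTorusLimitOfMixture.expect_relabel_spinSwap_sub_eq_zero_of_sectorGibbs (t t' U n β : ℝ)
    {ω : InfVolFermionState 2} {Ls : ℕ → ℕ}
    (h : ω.IsTorusLimitOfMixture (sectorGibbsCount n) (fun L => sectorGibbsWeightTT' β t t' U n L)
      (fun L => sectorGibbsVectorTT' t t' U n L) Ls)
    (hLs : Tendsto Ls atTop atTop) {Λ' : Finset (Site 2)} (Y : FermionOp Λ') :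
    ω.expect Λ' (relabel (Orb.spinSwap : Orb (PolySite Λ') ≃ Orb (PolySite Λ')) Y - Y) = 0 := by
  rw [map_sub, ← spinFlip_expect, h.spinFlip_eq_of_sectorGibbs t t' U n β hLs, sub_self]

end InfVolFermionState

end Torus

end Literature.MathematicalPhysics.QuantumLattice

end
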